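import Summits.Ventures.PackingBounds.Energy.NewtonCertificateDeficit
import Summits.Ventures.PackingBounds.Energy.UniversalOptimalityIcosahedron

/-!
# Energy rigidity for the regular icosahedron: every 12-point ground state on `S²` is an optimal code

Framing: lottery ticket; floor = certified bounds/negative ranges. Venture `PackingBounds` (cell
`pub-packcert`, seat `pub-packcert-energy`). The `ℚ(√5)` companion of the generated `…EnergyRigidity` files
(those cover Cohn–Kumar's rational rows): the icosahedron's Newton certificate of
`Energy/UniversalOptimalityIcosahedron.lean` (nodes `-1, ∓1/√5`, doubled, `D = 6`, Legendre table over
`ℚ(√5)`) fed to the generic deficit inequality `NewtonCert.energy_deficit`. Consequences: a `12`-point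
configuration on `S²` attaining the universal lower bound of the `(1+t)^k`-energy for one `k ≥ 6` has all
pairwise inner products in the node set `{-1, -1/√5, 1/√5}` (`inner_mem_of_ckPow_energy_eq`), in particular
`≤ 1/√5` (`inner_le_of_ckPow_energy_eq`): every ground state is an optimal `12`-point spherical code with the
icosahedron's angle `arccos(1/√5)` (Cohn–Kumar 2007, Thm. 1.2, necessary condition for a minimiser; the
icosahedron is the unique such code — Fejes Tóth — which is not formalised here).

## References
* H. Cohn, A. Kumar, J. Amer. Math. Soc. 20 (2007) 99–148, Theorem 1.2, Table 1. [`CohnKumar2006`]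
-/

noncomputable section

namespace Summit.Ventures.PackingBounds.Config.IcosahedronEnergyRigidity

open Finset Literature.Analysis.SpecialFunctions Literature.Geometry.DiscreteGeometry
  Summit.Ventures.PackingBounds.Energy

/-- Explicit form of the Gegenbauer polynomial `C_0^(1 / 2)` of the tree. [folklore] -/
private theorem c1_2_0 (t : ℝ) : gegenbauerSum (1 / 2 : ℝ) 0 t =
    (1 : ℝ) := by
  simp [gegenbauerSum, gegenbauerCoeff]

/-- Explicit form of the Gegenbauer polynomial `C_1^(1 / 2)` of the tree. [folklore] -/
private theorem c1_2_1 (t : ℝ) : gegenbauerSum (1 / 2 : ℝ) 1 t =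
    (1 : ℝ) * t := by
  rw [gegenbauerSum_one]
  ring

/-- Explicit form of the Gegenbauer polynomial `C_2^(1 / 2)` of the tree. [folklore] -/
private theorem c1_2_2 (t : ℝ) : gegenbauerSum (1 / 2 : ℝ) 2 t =
    (-1 / 2 : ℝ) + (3 / 2 : ℝ) * t ^ 2 := by
  simp [gegenbauerSum, gegenbauerCoeff, Finset.sum_range_succ, Finset.prod_range_succ,
    Nat.factorial]
  ring

/-- Explicit form of the Gegenbauer polynomial `C_3^(1 / 2)` of the tree. [folklore] -/
private theorem c1_2_3 (t : ℝ) : gegenbauerSum (1 / 2 : ℝ) 3 t =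
    (-3 / 2 : ℝ) * t + (5 / 2 : ℝ) * t ^ 3 := by
  simp [gegenbauerSum, gegenbauerCoeff, Finset.sum_range_succ, Finset.prod_range_succ,
    Nat.factorial]
  ring

/-- Explicit form of the Gegenbauer polynomial `C_4^(1 / 2)` of the tree. [folklore] -/
private theorem c1_2_4 (t : ℝ) : gegenbauerSum (1 / 2 : ℝ) 4 t =
    (3 / 8 : ℝ) + (-15 / 4 : ℝ) * t ^ 2 + (35 / 8 : ℝ) * t ^ 4 := by
  simp [gegenbauerSum, gegenbauerCoeff, Finset.sum_range_succ, Finset.prod_range_succ,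
    Nat.factorial]
  ring

/-- Explicit form of the Gegenbauer polynomial `C_5^(1 / 2)` of the tree. [folklore] -/
private theorem c1_2_5 (t : ℝ) : gegenbauerSum (1 / 2 : ℝ) 5 t =
    (15 / 8 : ℝ) * t + (-35 / 4 : ℝ) * t ^ 3 + (63 / 8 : ℝ) * t ^ 5 := by
  simp [gegenbauerSum, gegenbauerCoeff, Finset.sum_range_succ, Finset.prod_range_succ,
    Nat.factorial]
  ring

/-- `2.236 < √5 < 2.2361` and `(√5)² = 5`. [folklore] -/
private theorem sqrt5_facts :
    Real.sqrt 5 ^ 2 = 5 ∧ (2236 / 1000 : ℝ) < Real.sqrt 5 ∧ Real.sqrt 5 < 22361 / 10000 := by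
  refine ⟨Real.sq_sqrt (by norm_num), ?_, ?_⟩
  · rw [show (2236 / 1000 : ℝ) = Real.sqrt ((2236 / 1000) ^ 2) by
      rw [Real.sqrt_sq (by norm_num)]]
    exact Real.sqrt_lt_sqrt (by norm_num) (by norm_num)
  · rw [show (22361 / 10000 : ℝ) = Real.sqrt ((22361 / 10000) ^ 2) by
      rw [Real.sqrt_sq (by norm_num)]]
    exact Real.sqrt_lt_sqrt (by norm_num) (by norm_num)

/-- Node values `v_i = 1 + t_i` of the certificate (doubled sequence `0, 1 - √5/5, 1 + √5/5` twice). -/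
def vt (i : ℕ) : ℝ :=
  match i with
  | 0 => (0 : ℝ) | 1 => 1 - Real.sqrt 5 / 5 | 2 => 1 + Real.sqrt 5 / 5 | 3 => 0
  | 4 => 1 - Real.sqrt 5 / 5 | 5 => 1 + Real.sqrt 5 / 5 | _ => 0

/-- Distance distribution of the icosahedron at the nodes: `1, 5, 5`. -/
def multt (i : ℕ) : ℝ :=
  match i with | 0 => (1 : ℝ) | 1 => 5 | 2 => 5 | _ => 0

/-- Legendre (`C^(1/2)`) expansion table of the six Newton partial products (row `j`, column `i`), entries in `ℚ(√5)`. -/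
def Gt (j i : ℕ) : ℝ :=
  match j with
  | 0 => (match i with
      | 0 => (1 : ℝ) | _ => 0)
  | 1 => (match i with
      | 0 => (1 : ℝ) | 1 => (1 : ℝ) | _ => 0)
  | 2 => (match i with
      | 0 => (1 / 3 : ℝ) + (1 / 5 : ℝ) * Real.sqrt 5
      | 1 => (1 : ℝ) + (1 / 5 : ℝ) * Real.sqrt 5 | 2 => (2 / 3 : ℝ) | _ => 0)
  | 3 => (match i with
      | 0 => (2 / 15 : ℝ) | 1 => (2 / 5 : ℝ) | 2 => (2 / 3 : ℝ) | 3 => (2 / 5 : ℝ) | _ => 0)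
  | 4 => (match i with
      | 0 => (4 / 15 : ℝ) | 1 => (4 / 5 : ℝ) | 2 => (116 / 105 : ℝ) | 3 => (4 / 5 : ℝ)
      | 4 => (8 / 35 : ℝ) | _ => 0)
  | 5 => (match i with
      | 0 => (4 / 15 : ℝ) + (4 / 75 : ℝ) * Real.sqrt 5
      | 1 => (124 / 175 : ℝ) + (4 / 25 : ℝ) * Real.sqrt 5
      | 2 => (92 / 105 : ℝ) + (116 / 525 : ℝ) * Real.sqrt 5
      | 3 => (172 / 225 : ℝ) + (4 / 25 : ℝ) * Real.sqrt 5
      | 4 => (16 / 35 : ℝ) + (8 / 175 : ℝ) * Real.sqrt 5 | 5 => (8 / 63 : ℝ) | _ => 0)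
  | _ => 0

/-- The doubled node polynomial `ω = ∏_{i<6} (1 + t - v_i)` in the inner product `t`. -/
def omegat (t : ℝ) : ℝ := ∏ i ∈ range 6, (1 + t - vt i)

/-- `ω` factored as a square: `ω(t) = ((1+t)(t² - 1/5))²`. -/
theorem omegat_eq (t : ℝ) : omegat t = ((1 + t) * (t ^ 2 - 1 / 5)) ^ 2 := by
  have h5 : Real.sqrt 5 ^ 2 = 5 := Real.sq_sqrt (by norm_num)
  simp only [omegat, Finset.prod_range_succ, Finset.prod_range_zero, vt]
  linear_combination ((1 + t) ^ 2 * ((Real.sqrt 5 ^ 2 + 5) / 625 - 2 * t ^ 2 / 25)) * h5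

/-- `ω ≥ 0`. -/
theorem omegat_nonneg (t : ℝ) : 0 ≤ omegat t := by
  rw [omegat_eq]; exact sq_nonneg _

/-- A zero of `ω` is a node: `t = -1` or `t² = 1/5`. -/
theorem node_of_omegat_eq_zero {t : ℝ} (h : omegat t = 0) : t = -1 ∨ t ^ 2 = 1 / 5 := by
  rw [omegat_eq, sq_eq_zero_iff] at h
  rcases mul_eq_zero.mp h with h | h
  · left; linarith
  · right; linarith

/-- A zero of `ω` is `≤ 1/√5 = √5/5`. -/
theorem le_of_omegat_eq_zero {t : ℝ} (h : omegat t = 0) : t ≤ Real.sqrt 5 / 5 := by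
  obtain ⟨h5, hlo, _⟩ := sqrt5_facts
  rcases node_of_omegat_eq_zero h with h | h
  · rw [h]; nlinarith [hlo]
  · by_contra hlt
    rw [not_le] at hlt
    have h0 : 0 < Real.sqrt 5 / 5 := by nlinarith [hlo]
    nlinarith [mul_lt_mul'' hlt hlt h0.le h0.le]

section config

variable {C : Finset (EuclideanSpace ℝ (Fin 3))} (h1 : ∀ x ∈ C, ‖x‖ = 1) (hN : C.card = 12)
include h1 hN

set_option maxHeartbeats 1600000 in
open scoped Classical in
/-- **Deficit inequality** for the icosahedron certificate (`k ≥ 6`): energy minus the universal bound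
dominates `Σ_{x ≠ y} (1 + ⟨x,y⟩)^{k-6} ω(⟨x,y⟩) ≥ 0`. [cite: CohnKumar2006, Theorem 1.2 and §6] -/
theorem ckPow_energy_deficit (k : ℕ) (hk : 6 ≤ k) :
    (12 : ℝ) * ((1 + (-1 : ℝ)) ^ k + 5 * (1 + (-(Real.sqrt 5 / 5))) ^ k
        + 5 * (1 + Real.sqrt 5 / 5) ^ k) +
      ∑ x ∈ C, ∑ y ∈ C.erase x, (1 + inner ℝ x y) ^ (k - 6) * omegat (inner ℝ x y) ≤
      ∑ x ∈ C, ∑ y ∈ C.erase x, (1 + inner ℝ x y) ^ k := by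
  obtain ⟨h5, hlo, hhi⟩ := sqrt5_facts
  have key := NewtonCert.energy_deficit (n := 3) (μ := 1 / 2) (by norm_num) (by norm_num) 6
    (by norm_num) vt ?hv ?hsq Gt ?hG ?hGid 12 3 (by norm_num) multt ?hdes k hk C h1 hN
  case hv => intro i; unfold vt; split <;> nlinarith [hlo, hhi]
  case hsq =>
    exact fun u _ => NewtonCert.omega_doubled_nonneg _ 3 (fun i hi => by
      interval_cases i <;> simp [vt]) u
  case hG =>
    intro j i
    unfold Gt
    split <;> (first | (split <;> nlinarith [hlo, hhi]) | norm_num)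
  case hGid =>
    intro j hj t
    interval_cases j
    · simp only [Finset.prod_range_zero, Finset.sum_range_succ, Finset.sum_range_zero, c1_2_0, c1_2_1, c1_2_2, c1_2_3, c1_2_4, c1_2_5, Gt, vt]
      linear_combination ((0 : ℝ)) * h5
    · simp only [Finset.prod_range_succ, Finset.prod_range_zero, Finset.sum_range_succ,
        Finset.sum_range_zero, c1_2_0, c1_2_1, c1_2_2, c1_2_3, c1_2_4, c1_2_5, Gt, vt]
      linear_combination ((0 : ℝ)) * h5
    · simp only [Finset.prod_range_succ, Finset.prod_range_zero, Finset.sum_range_succ,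
        Finset.sum_range_zero, c1_2_0, c1_2_1, c1_2_2, c1_2_3, c1_2_4, c1_2_5, Gt, vt]
      linear_combination ((0 : ℝ)) * h5
    · simp only [Finset.prod_range_succ, Finset.prod_range_zero, Finset.sum_range_succ,
        Finset.sum_range_zero, c1_2_0, c1_2_1, c1_2_2, c1_2_3, c1_2_4, c1_2_5, Gt, vt]
      linear_combination ((-1 / 25 : ℝ) + (-1 / 25 : ℝ) * t) * h5
    · simp only [Finset.prod_range_succ, Finset.prod_range_zero, Finset.sum_range_succ,
        Finset.sum_range_zero, c1_2_0, c1_2_1, c1_2_2, c1_2_3, c1_2_4, c1_2_5, Gt, vt]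
      linear_combination ((-1 / 25 : ℝ) + (-2 / 25 : ℝ) * t + (-1 / 25 : ℝ) * t ^ 2) * h5
    · simp only [Finset.prod_range_succ, Finset.prod_range_zero, Finset.sum_range_succ,
        Finset.sum_range_zero, c1_2_0, c1_2_1, c1_2_2, c1_2_3, c1_2_4, c1_2_5, Gt, vt]
      linear_combination ((-1 / 25 : ℝ) * t + (-2 / 25 : ℝ) * t ^ 2 + (-1 / 25 : ℝ) * t ^ 3 + (-1 / 125 : ℝ) * Real.sqrt 5 + (-2 / 125 : ℝ) * Real.sqrt 5 * t + (-1 / 125 : ℝ) * Real.sqrt 5 * t ^ 2) * h5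
  case hdes =>
    intro j hj
    interval_cases j
    · simp only [Finset.prod_range_zero, Finset.sum_range_succ, Finset.sum_range_zero, Gt, vt, multt]
      push_cast
      linear_combination ((0 : ℝ)) * h5
    · simp only [Finset.prod_range_succ, Finset.prod_range_zero, Finset.sum_range_succ,
        Finset.sum_range_zero, Gt, vt, multt]
      push_cast
      linear_combination ((0 : ℝ)) * h5
    · simp only [Finset.prod_range_succ, Finset.prod_range_zero, Finset.sum_range_succ,
        Finset.sum_range_zero, Gt, vt, multt]
      push_cast
      linear_combination ((-2 / 5 : ℝ)) * h5
    · simp only [Finset.prod_range_succ, Finset.prod_range_zero, Finset.sum_range_succ,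
        Finset.sum_range_zero, Gt, vt, multt]
      push_cast
      linear_combination ((2 / 25 : ℝ)) * h5
    · simp only [Finset.prod_range_succ, Finset.prod_range_zero, Finset.sum_range_succ,
        Finset.sum_range_zero, Gt, vt, multt]
      push_cast
      linear_combination ((4 / 25 : ℝ)) * h5
    · simp only [Finset.prod_range_succ, Finset.prod_range_zero, Finset.sum_range_succ,
        Finset.sum_range_zero, Gt, vt, multt]
      push_cast
      linear_combination ((4 / 25 : ℝ) + (4 / 125 : ℝ) * Real.sqrt 5) * h5
  have hval : ((12 : ℕ) : ℝ) * ∑ i ∈ range 3, multt i * vt i ^ k =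
      (12 : ℝ) * ((1 + (-1 : ℝ)) ^ k + 5 * (1 + (-(Real.sqrt 5 / 5))) ^ k
        + 5 * (1 + Real.sqrt 5 / 5) ^ k) := by
    simp only [Finset.sum_range_succ, Finset.sum_range_zero, multt, vt]
    push_cast
    ring
  rw [hval] at key
  exact key

/-- **Rigidity (node set).** A `12`-point configuration on `S²` attaining the universal bound of the
`(1+t)^k`-energy for one `k ≥ 6` has all pairwise inner products in `{-1} ∪ {t : t² = 1/5}`, the
icosahedron's inner products. -/
theorem inner_mem_of_ckPow_energy_eq (k : ℕ) (hk : 6 ≤ k)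
    (hE : ∑ x ∈ C, ∑ y ∈ C.erase x, (1 + inner ℝ x y) ^ k =
      (12 : ℝ) * ((1 + (-1 : ℝ)) ^ k + 5 * (1 + (-(Real.sqrt 5 / 5))) ^ k
        + 5 * (1 + Real.sqrt 5 / 5) ^ k)) :
    ∀ x ∈ C, ∀ y ∈ C, x ≠ y → inner ℝ x y = -1 ∨ inner ℝ x y ^ 2 = 1 / 5 := by
  classical
  have hdef := ckPow_energy_deficit h1 hN k hk
  rw [hE] at hdef
  have hnn : ∀ x ∈ C, ∀ y ∈ C.erase x, 0 ≤ (1 + inner ℝ x y) ^ (k - 6) * omegat (inner ℝ x y) := by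
    intro x hx y hy
    have hb := NewtonCert.inner_mem_Ico_of_norm_eq_one (h1 x hx) (h1 y (Finset.mem_of_mem_erase hy))
      (Finset.ne_of_mem_erase hy).symm
    exact mul_nonneg (pow_nonneg (by linarith [hb.1]) _) (omegat_nonneg _)
  have hsum0 : ∑ x ∈ C, ∑ y ∈ C.erase x, (1 + inner ℝ x y) ^ (k - 6) * omegat (inner ℝ x y) = 0 :=
    le_antisymm (by linarith) (Finset.sum_nonneg fun x hx => Finset.sum_nonneg fun y hy => hnn x hx y hy)
  intro x hx y hy hxy
  have hyx : y ∈ C.erase x := Finset.mem_erase.mpr ⟨hxy.symm, hy⟩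
  have hx0 := (Finset.sum_eq_zero_iff_of_nonneg fun x hx =>
    Finset.sum_nonneg fun y hy => hnn x hx y hy).mp hsum0 x hx
  have hxy0 := (Finset.sum_eq_zero_iff_of_nonneg fun y hy => hnn x hx y hy).mp hx0 y hyx
  rcases mul_eq_zero.mp hxy0 with h | h
  · have : 1 + inner ℝ x y = 0 := pow_eq_zero_iff (by
      intro h0; rw [h0, pow_zero] at h; exact one_ne_zero h) |>.mp h
    left; linarith
  · exact node_of_omegat_eq_zero h

/-- **Rigidity (optimal code).** A `12`-point configuration on `S²` attaining the universal bound of the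
`(1+t)^k`-energy for one `k ≥ 6` has all pairwise inner products `≤ 1/√5`: it is an optimal spherical code
with the icosahedron's minimal angle `arccos(1/√5)`. [cite: CohnKumar2006, Theorem 1.2] -/
theorem inner_le_of_ckPow_energy_eq (k : ℕ) (hk : 6 ≤ k)
    (hE : ∑ x ∈ C, ∑ y ∈ C.erase x, (1 + inner ℝ x y) ^ k =
      (12 : ℝ) * ((1 + (-1 : ℝ)) ^ k + 5 * (1 + (-(Real.sqrt 5 / 5))) ^ k
        + 5 * (1 + Real.sqrt 5 / 5) ^ k)) :
    ∀ x ∈ C, ∀ y ∈ C, x ≠ y → inner ℝ x y ≤ Real.sqrt 5 / 5 := by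
  obtain ⟨h5, hlo, _⟩ := sqrt5_facts
  intro x hx y hy hxy
  rcases inner_mem_of_ckPow_energy_eq h1 hN k hk hE x hx y hy hxy with h | h
  · rw [h]; nlinarith [hlo]
  · by_contra hlt
    rw [not_le] at hlt
    have h0 : 0 < Real.sqrt 5 / 5 := by nlinarith [hlo]
    nlinarith [mul_lt_mul'' hlt hlt h0.le h0.le]

end config

end Summit.Ventures.PackingBounds.Config.IcosahedronEnergyRigidity

end
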